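import Literature.NumberTheory.EllipticCurves.EichlerIntegralFrickeProofs
import Mathlib.MeasureTheory.Function.JacobianOneDim
import HarnessLib

/-!
# Fricke symmetry on the imaginary axis, integrated over a general split point
# (stub S2 of the fact skeleton `fricke-real-split` for `KMV2000.completedL_half_sq_eq`)

For `f ∈ S₂(Γ₀(N))` with the pointwise Fricke eigen-property `f(-1/(Nτ)) = ε N τ² f(τ)`
(`IsFrickeEigen N f ε`, Atkin–Lehner 1970 §2 / Thm. 3) and every `y > 0`,

  `∫_{v > 1/(Ny)} f(iv) dv = −ε ∫_{0 < u ≤ y} f(iu) du`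

— the substitution `v = 1/(Nu)` (`f(i/(Nu)) = −ε N u² f(iu)`, `dv = −du/(Nu²)`), done with Mathlib's
change-of-variables formula `integral_image_eq_integral_abs_deriv_smul` (no improper limits needed).
The tree's `IsFrickeEigen.integral_imagAxis_Ioc_eq` (Cremona 1997 §2.11) is the symmetric case
`y = 1/√N`; this is the general split used in the real-variable proof of KMV 2000 (21)–(22)
(cell landau-siegel / ls-inputs, H-AFE, seat ls-inputs-Hafe-lead g0). Proofs only.
-/

noncomputable section

open scoped Real
open Complex Set MeasureTheory CongruenceSubgroup UpperHalfPlane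

namespace Literature.NumberTheory.EllipticCurves.ModularForms

variable {N : ℕ} [NeZero N]

/-- Pointwise Fricke relation on the imaginary axis: `f(i/(Nv)) = −ε N v² f(iv)` for `v > 0`
(`w_N(iv) = i/(Nv)`, `(iv)² = −v²`; Cremona 1997 §2.11). [cite: CremonaAlgorithms1997, §2.11 (2.11.1)] -/
theorem IsFrickeEigen.apply_imagAxis_inv {f : CuspForm (Gamma0 N) 2} {ε : ℂ}
    (hW : IsFrickeEigen N f ε) {v : ℝ} (hv : 0 < v) :
    f (UpperHalfPlane.ofComplex (Complex.I * ((((N : ℝ) * v)⁻¹ : ℝ) : ℂ))) =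
      -ε * ((N : ℂ) * (v : ℂ) ^ 2) * f (UpperHalfPlane.ofComplex (Complex.I * v)) := by
  have h := hW (UpperHalfPlane.ofComplex (Complex.I * v))
  rw [frickePoint_ofComplex_I_mul hv,
    coe_ofComplex_of_im_pos (show 0 < (Complex.I * (v : ℂ)).im by simpa using hv)] at h
  rw [h, mul_pow, Complex.I_sq]
  ring

/-- The inversion `u ↦ 1/(Nu)` maps `(0, y)` onto `(1/(Ny), ∞)`. [folklore] -/
private lemma image_inv_mul_Ioo {y : ℝ} (hy : 0 < y) :
    (fun u : ℝ ↦ ((N : ℝ) * u)⁻¹) '' Ioo 0 y = Ioi (((N : ℝ) * y)⁻¹) := by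
  have hN : (0 : ℝ) < N := by exact_mod_cast NeZero.pos N
  ext v
  constructor
  · rintro ⟨u, hu, rfl⟩
    exact inv_strictAnti₀ (by have := hu.1; positivity) (mul_lt_mul_of_pos_left hu.2 hN)
  · intro hv
    have hv0 : 0 < v := lt_trans (by positivity) hv
    refine ⟨((N : ℝ) * v)⁻¹, ⟨by positivity, ?_⟩, by field_simp⟩
    calc ((N : ℝ) * v)⁻¹ < ((N : ℝ) * ((N : ℝ) * y)⁻¹)⁻¹ :=
          inv_strictAnti₀ (by positivity) (mul_lt_mul_of_pos_left hv hN)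
      _ = y := by field_simp

/-- **Fricke symmetry on the imaginary axis, integrated** (general split point): if
`f(-1/(Nτ)) = ε N τ² f(τ)` on `ℍ` then for every `y > 0`,
`∫_{v > 1/(Ny)} f(iv) dv = −ε ∫_{0 < u ≤ y} f(iu) du` (substitution `v = 1/(Nu)`; Cremona 1997,
§2.11, proof of (2.11.1), there at `y = 1/√N`). [cite: CremonaAlgorithms1997, §2.11 (2.11.1)] -/
theorem IsFrickeEigen.integral_imagAxis_Ioi_inv_mul {f : CuspForm (Gamma0 N) 2} {ε : ℂ}
    (hW : IsFrickeEigen N f ε) {y : ℝ} (hy : 0 < y) :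
    ∫ v in Ioi (((N : ℝ) * y)⁻¹), f (UpperHalfPlane.ofComplex (Complex.I * v)) =
      -ε * ∫ u in Ioc (0 : ℝ) y, f (UpperHalfPlane.ofComplex (Complex.I * u)) := by
  have hN : (0 : ℝ) < N := by exact_mod_cast NeZero.pos N
  set φ : ℝ → ℝ := fun u ↦ ((N : ℝ) * u)⁻¹ with hφ
  set φ' : ℝ → ℝ := fun u ↦ -((N : ℝ) * u ^ 2)⁻¹ with hφ'
  have hderiv : ∀ u ∈ Ioo (0 : ℝ) y, HasDerivWithinAt φ (φ' u) (Ioo 0 y) u := by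
    intro u hu
    have hu0 : u ≠ 0 := hu.1.ne'
    have hφ_eq : φ = fun u ↦ (N : ℝ)⁻¹ * u⁻¹ := by funext u; simp only [hφ, mul_inv]
    rw [hφ_eq]
    refine (((hasDerivAt_inv hu0).const_mul ((N : ℝ)⁻¹)).congr_deriv ?_).hasDerivWithinAt
    simp only [hφ']
    rw [mul_inv]
    ring
  have hinj : InjOn φ (Ioo 0 y) := by
    intro u _ v _ huv
    simp only [hφ] at huv
    exact mul_left_cancel₀ hN.ne' (inv_injective huv)
  rw [← image_inv_mul_Ioo (N := N) hy, integral_image_eq_integral_abs_deriv_smul measurableSet_Ioo hderiv hinj,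
    integral_Ioc_eq_integral_Ioo, ← integral_const_mul]
  refine setIntegral_congr_fun measurableSet_Ioo fun u hu ↦ ?_
  have hu0 : 0 < u := hu.1
  simp only [hφ, hφ', Complex.real_smul]
  rw [hW.apply_imagAxis_inv hu0, abs_neg, abs_of_pos (by positivity)]
  have hu' : (u : ℂ) ≠ 0 := by exact_mod_cast hu0.ne'
  have hN' : (N : ℂ) ≠ 0 := by exact_mod_cast hN.ne'
  push_cast
  field_simp

/-- Stub **S2** of the fact skeleton `fricke-real-split` (crux workfile
`Cruxes/BeyondDiagonalBeatsQuarter/Lines/fricke_real_split.lean` on stmt-Parity-20343), in its registered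
quantifier shape. [cite: CremonaAlgorithms1997, §2.11 (2.11.1)] -/
theorem IsFrickeEigen.integral_imagAxis_Ioi_inv_mul_all :
    ∀ (N : ℕ) [NeZero N] (f : CuspForm (Gamma0 N) 2) (ε : ℂ), IsFrickeEigen N f ε →
      ∀ y : ℝ, 0 < y →
        ∫ v in Ioi (((N : ℝ) * y)⁻¹), f (UpperHalfPlane.ofComplex (Complex.I * v)) =
          -ε * ∫ u in Ioc (0 : ℝ) y, f (UpperHalfPlane.ofComplex (Complex.I * u)) :=
  fun _ _ _ _ hW _ hy ↦ hW.integral_imagAxis_Ioi_inv_mul hy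

/-! ### The same with the logarithmic weight `(log √N v)^k` (appended; cell landau-siegel / ls-inputs,
line H-AFE2 = KMV 2000 (21)–(22) at order `k`, stub T2 of the fact skeleton `log-fricke-split`):
under `v = 1/(Nu)` one has `√N v = (√N u)⁻¹`, so the weight picks up the sign `(−1)^k`. -/

/-- Under `v = 1/(Nu)`: `log(√N · (Nu)⁻¹) = −log(√N u)` for `u > 0` (`√N/(Nu) = (√N u)⁻¹`). [folklore] -/
private lemma log_sqrt_mul_inv_mul {u : ℝ} (hu : 0 < u) :
    Real.log (Real.sqrt N * ((N : ℝ) * u)⁻¹) = -Real.log (Real.sqrt N * u) := by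
  have hN : (0 : ℝ) < N := by exact_mod_cast NeZero.pos N
  have hs : 0 < Real.sqrt N := Real.sqrt_pos.mpr hN
  have h : Real.sqrt N * ((N : ℝ) * u)⁻¹ = (Real.sqrt N * u)⁻¹ := by
    have hs2 : Real.sqrt N * Real.sqrt N = N := Real.mul_self_sqrt hN.le
    refine eq_inv_of_mul_eq_one_left ?_
    field_simp
    linear_combination hs2
  rw [h, Real.log_inv]

/-- **Fricke symmetry on the imaginary axis with the weight `(log √N v)^k`**: if
`f(-1/(Nτ)) = ε N τ² f(τ)` on `ℍ` then for every `k` and `y > 0`,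
`∫_{v > 1/(Ny)} f(iv) (log √N v)^k dv = (−1)^k (−ε) ∫_{0 < u ≤ y} f(iu) (log √N u)^k du`
(substitution `v = 1/(Nu)`: `f(i/(Nu)) = −εNu² f(iu)`, `log(√N/(Nu)) = −log(√N u)`; `k = 0` is
`integral_imagAxis_Ioi_inv_mul`). This is the sign bookkeeping behind «the functional equation for
`Λ(f, 1/2 + s)` has always sign `+1`» in KMV 2000 (22) at order `k`.
[cite: KowalskiMichelVanderKam2000, (21)–(22) p. 12] -/
theorem IsFrickeEigen.integral_imagAxis_Ioi_inv_mul_logPow {f : CuspForm (Gamma0 N) 2} {ε : ℂ}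
    (hW : IsFrickeEigen N f ε) (k : ℕ) {y : ℝ} (hy : 0 < y) :
    ∫ v in Ioi (((N : ℝ) * y)⁻¹), f (UpperHalfPlane.ofComplex (Complex.I * v)) *
        (((Real.log (Real.sqrt N * v)) ^ k : ℝ) : ℂ) =
      (-1) ^ k * (-ε) * ∫ u in Ioc (0 : ℝ) y, f (UpperHalfPlane.ofComplex (Complex.I * u)) *
        (((Real.log (Real.sqrt N * u)) ^ k : ℝ) : ℂ) := by
  have hN : (0 : ℝ) < N := by exact_mod_cast NeZero.pos N
  set φ : ℝ → ℝ := fun u ↦ ((N : ℝ) * u)⁻¹ with hφ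
  set φ' : ℝ → ℝ := fun u ↦ -((N : ℝ) * u ^ 2)⁻¹ with hφ'
  have hderiv : ∀ u ∈ Ioo (0 : ℝ) y, HasDerivWithinAt φ (φ' u) (Ioo 0 y) u := by
    intro u hu
    have hu0 : u ≠ 0 := hu.1.ne'
    have hφ_eq : φ = fun u ↦ (N : ℝ)⁻¹ * u⁻¹ := by funext u; simp only [hφ, mul_inv]
    rw [hφ_eq]
    refine (((hasDerivAt_inv hu0).const_mul ((N : ℝ)⁻¹)).congr_deriv ?_).hasDerivWithinAt
    simp only [hφ']
    rw [mul_inv]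
    ring
  have hinj : InjOn φ (Ioo 0 y) := by
    intro u _ v _ huv
    simp only [hφ] at huv
    exact mul_left_cancel₀ hN.ne' (inv_injective huv)
  rw [← image_inv_mul_Ioo (N := N) hy, integral_image_eq_integral_abs_deriv_smul measurableSet_Ioo hderiv hinj,
    integral_Ioc_eq_integral_Ioo, ← integral_const_mul]
  refine setIntegral_congr_fun measurableSet_Ioo fun u hu ↦ ?_
  have hu0 : 0 < u := hu.1
  simp only [hφ, hφ', Complex.real_smul]
  rw [hW.apply_imagAxis_inv hu0, abs_neg, abs_of_pos (by positivity), log_sqrt_mul_inv_mul hu0, neg_pow]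
  have hu' : (u : ℂ) ≠ 0 := by exact_mod_cast hu0.ne'
  have hN' : (N : ℂ) ≠ 0 := by exact_mod_cast hN.ne'
  push_cast
  field_simp

/-- Stub **T2** of the fact skeleton `log-fricke-split` (crux workfile
`Cruxes/BeyondDiagonalBeatsQuarter/Lines/log_fricke_split.lean` on stmt-Parity-20343), in its registered
quantifier shape. [cite: KowalskiMichelVanderKam2000, (21)–(22) p. 12] -/
theorem IsFrickeEigen.integral_imagAxis_Ioi_inv_mul_logPow_all :
    ∀ (N : ℕ) [NeZero N] (f : CuspForm (Gamma0 N) 2) (ε : ℂ), IsFrickeEigen N f ε →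
      ∀ (k : ℕ) (y : ℝ), 0 < y →
        ∫ v in Ioi (((N : ℝ) * y)⁻¹), f (UpperHalfPlane.ofComplex (Complex.I * v)) *
            (((Real.log (Real.sqrt N * v)) ^ k : ℝ) : ℂ) =
          (-1) ^ k * (-ε) * ∫ u in Ioc (0 : ℝ) y, f (UpperHalfPlane.ofComplex (Complex.I * u)) *
            (((Real.log (Real.sqrt N * u)) ^ k : ℝ) : ℂ) :=
  fun _ _ _ _ hW k _ hy ↦ hW.integral_imagAxis_Ioi_inv_mul_logPow k hy

end Literature.NumberTheory.EllipticCurves.ModularForms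

end
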